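import Summits.BirchSwinnertonDyer.BirchSwinnertonDyer.Theorems.GenusKolyvaginAtTwoEquivariantKolyvaginExactAtTwoDualityRat
import Summits.BirchSwinnertonDyer.BirchSwinnertonDyer.Theorems.GenusKolyvaginAtTwoEquivariantKolyvaginExactAtTwoTwinGrossPrimes
import Literature.NumberTheory.EllipticCurves.VariableChangePointsMap
import Literature.NumberTheory.EllipticCurves.GlobalMinimalModelProofs
import HarnessLib

/-!
# Route `GenusKolyvaginAtTwo`, LINE 6, KEY crux Q3 (inner statement of stmt-BirchSwinnertonDyer-22137):
# McCallum's Lemma 5.3 with Prop. 2.2 over `ℚ_ℓ` at `p = 2` for the TWIN `E^{(d_K)}` — field `duality₂`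
# of gk2-p2's `KolyvaginDescent.VisiblePairHypothesesM` (p632473), unconditional

Helper (seat `bsd-line-gk2-p3` g12; `--supports` the crux, closes nothing). This lineage's `…DualityRat`
(`lemma_5_3_rat_two_of_card`, `lemma_5_3_rat_two`) is the field `duality₁` of the pair descent at `2` for the
member `E`: from `#E(ℚ_ℓ)[2^M] = 2^M` at a Gross–Kolyvagin prime `ℓ` of depth `≥ M`, Tate local duality and
Poitou–Tate give `2^{M−1−a}·s ∈ torsionLocalKer_ℓ` for Selmer `s` against an almost-Selmer `d` with
`2^a d ∉ 𝓛_ℓ`. The second member of Kolyvagin's pair is the twin `E^{(d_K)}`; g11's `…TwinGrossPrimes`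
proved the COUNT `#E′(ℚ_ℓ)[2^M] = 2^M` for every globally minimal model `E′` of the twin
(`natCard_ker_zsmul_adicCompletion_two_pow_eq_twin`). This file closes the loop for the equation
`W.quadraticTwist d_K` itself (the one `hPsiKT`, `…EigenClassesFinite`, `…TwistLocalConditions`,
`…PropFourFourRat` are written for):

* `natCard_ker_zsmul_baseChange_eq_of_smul_eq` — the count `#ker(n : W(L) → W(L))` is an invariant of the
  `F`-isomorphism class (`C • W₁ = W₂`; the tree's `VariableChange.pointEquivBaseChange`), any field `L ⊇ F`;
* `natCard_ker_nsmul_quadraticTwist_adicCompletion_two_pow_eq` — **`#E^{(d_K)}(ℚ_ℓ)[2^M] = 2^M`** for the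
  equation `W.quadraticTwist d_K` (a global minimal model exists over `ℚ`, `hasGlobalMinimalModel_rat_holds`;
  g11's twin count on it; transport back);
* `lemma_5_3_rat_two_quadraticTwist` — **field `duality₂`**: for `s ∈ Sel^{(q)}(E^{(d_K)}/ℚ)`, `q = 2^M`,
  `d` Selmer off `ℓ` with `2^a d ∉ 𝓛_ℓ`: `2^{M−1−a}·s ∈ torsionLocalKer_ℓ(E^{(d_K)}/ℚ)` — at every
  Gross–Kolyvagin prime `ℓ` OF `E` (odd, good, `ℓ ∤ d_K`, `Frob_ℓ ∼ Frob_∞` on `E[2]`, index `≥ M`), `E`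
  globally minimal with `Δ(E) < 0`, `K` imaginary quadratic with `d_K` odd.

THEOREMS ONLY (no definition, no named fact, no `sorry`, standard axioms). BSD is not proved by any of this.

References: [McCallumLMS1991] §5 Lemma 5.3, §2 Prop. 2.2; [GrossLMS1991] §3 (3.2)–(3.3), Prop. 6.2 (2);
[Kolyvagin1989Izv] §3 (the pair `(E, E^D)`); [SilvermanAEC2009] III.1 Table 3.1, VIII.8, X.5 Cor. 5.4;
[MilneADT2006] I Cor. 3.4.
-/

set_option autoImplicit false
set_option linter.dupNamespace false -- tree convention: `Summit.BirchSwinnertonDyer.BirchSwinnertonDyer.Theorems` (summit = sub-problem)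

noncomputable section

open scoped Classical

universe u v

namespace Summit.BirchSwinnertonDyer.BirchSwinnertonDyer.Theorems.GenusExact.FrobeniusCriterion

open WeierstrassCurve NumberField IsDedekindDomain Field
open Literature.NumberTheory.EllipticCurves Literature.NumberTheory.GaloisRepresentations
open Summit.BirchSwinnertonDyer.BirchSwinnertonDyer.Theorems.GenusExact.TwinGrossPrimes

/-! ## §1 The local torsion count is an isomorphism invariant -/

/-- **`#ker(n : W₁(L) → W₁(L)) = #ker(n : W₂(L) → W₂(L))` for `F`-isomorphic equations `C • W₁ = W₂`** and
any field `L ⊇ F` (the change of variables is an isomorphism of the groups of `L`-points,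
`VariableChange.pointEquivBaseChange`). [cite: SilvermanAEC2009, III.1 Table 3.1] -/
theorem natCard_ker_zsmul_baseChange_eq_of_smul_eq {F : Type u} [Field F] {W₁ W₂ : WeierstrassCurve F}
    {C : VariableChange F} (hC : C • W₁ = W₂) (L : Type v) [Field L] [Algebra F L] (n : ℤ) :
    Nat.card (zsmulAddGroupHom n : (W₁.baseChange L).toAffine.Point →+ _).ker =
      Nat.card (zsmulAddGroupHom n : (W₂.baseChange L).toAffine.Point →+ _).ker := by
  subst hC
  refine Nat.card_congr
    ((VariableChange.pointEquivBaseChange W₁ C L).toEquiv.subtypeEquiv fun P ↦ ?_)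
  simp only [AddMonoidHom.mem_ker, zsmulAddGroupHom_apply, AddEquiv.toEquiv_eq_coe,
    EquivLike.coe_coe, ← map_zsmul]
  exact (EmbeddingLike.map_eq_zero_iff (f := VariableChange.pointEquivBaseChange W₁ C L)).symm

/-! ## §2 The count for the twin equation and the field `duality₂` -/

variable (W : WeierstrassCurve ℚ) [W.IsElliptic] [W.IsGloballyMinimal] {K : Type} [Field K] [NumberField K]

/-- **`#E^{(d_K)}(ℚ_ℓ)[2^M] = 2^M` for the twist equation `W.quadraticTwist d_K`** at a Gross–Kolyvagin prime
`ℓ` of `(E, K)` of index `≥ M` (`E` globally minimal, `Δ(E) < 0`, `K` imaginary quadratic with `d_K` odd, `ℓ`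
odd of good reduction for `E`, `ℓ ∤ d_K`, `Frob_ℓ ∼ Frob_∞` on `E[2]`): g11's
`natCard_ker_zsmul_adicCompletion_two_pow_eq_twin` on a global minimal model `C • W.quadraticTwist d_K`
(`hasGlobalMinimalModel_rat_holds`), transported back along `C` (§1). [cite: McCallumLMS1991, §5 Lemma 5.3]
[cite: GrossLMS1991, §3 (3.2)–(3.3)] -/
theorem natCard_ker_nsmul_quadraticTwist_adicCompletion_two_pow_eq (hK : IsImaginaryQuadratic K)
    (hodd : Odd (NumberField.discr K)) (hΔ : W.Δ < 0)
    [(W.quadraticTwist ((NumberField.discr K : ℤ) : ℚ)).IsElliptic]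
    {ℓ : ℕ} [Fact ℓ.Prime] (hℓ2 : ℓ ≠ 2) (hℓd : ¬ ((ℓ : ℤ) ∣ NumberField.discr K))
    (hgoodℓ : W.HasGoodReductionAtPrime ℓ) (hℓ : FrobEqFrobInfty W K 2 ℓ)
    {v : HeightOneSpectrum (𝓞 ℚ)} (hv : (ℓ : 𝓞 ℚ) ∈ v.asIdeal) {M : ℕ}
    (hM : M ≤ Zhang2014.kolyvaginIndex W 2 ℓ) {q : ℕ} (hq : q = 2 ^ M) :
    Nat.card (nsmulAddMonoidHom q :
        ((W.quadraticTwist ((NumberField.discr K : ℤ) : ℚ)).baseChange (v.adicCompletion ℚ)).toAffine.Point →+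
          _).ker = 2 ^ M := by
  obtain ⟨C, hC⟩ := hasGlobalMinimalModel_rat_holds (W.quadraticTwist ((NumberField.discr K : ℤ) : ℚ))
  haveI := hC
  rw [← zsmulAddGroupHom_natCast, natCard_ker_zsmul_baseChange_eq_of_smul_eq
    (rfl : C • W.quadraticTwist ((NumberField.discr K : ℤ) : ℚ) = _) (v.adicCompletion ℚ), hq]
  exact natCard_ker_zsmul_adicCompletion_two_pow_eq_twin W hK hodd hΔ
    (C • W.quadraticTwist ((NumberField.discr K : ℤ) : ℚ)) rfl hℓ2 hℓd hgoodℓ hℓ hv hM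

/-- **Field `duality₂` — McCallum's Lemma 5.3 with Prop. 2.2 over `ℚ_ℓ` at `p = 2` for the twin equation
`E′ = W.quadraticTwist d_K`, UNCONDITIONAL.** At a Gross–Kolyvagin prime `ℓ` of `(E, K)` of index `≥ M`
(hypotheses of `natCard_ker_nsmul_quadraticTwist_adicCompletion_two_pow_eq`), `q = 2^M`, `M ≥ 1`: for
`s ∈ Sel^{(q)}(E′/ℚ)` and `d ∈ H¹(ℚ, E′[q])` Selmer at the finite places `≠ v` and at `∞` with `2^a d` NOT
Selmer at `v ∋ ℓ`, **`2^{M−1−a}·s ∈ torsionLocalKer_v(E′/ℚ)`**. (`lemma_5_3_rat_two_of_card` for `E′` with the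
count above.) [cite: McCallumLMS1991, §5 Lemma 5.3 and §2 Prop. 2.2] [cite: MilneADT2006, Ch. I Cor. 3.4] -/
theorem lemma_5_3_rat_two_quadraticTwist (hK : IsImaginaryQuadratic K) (hodd : Odd (NumberField.discr K))
    (hΔ : W.Δ < 0) [(W.quadraticTwist ((NumberField.discr K : ℤ) : ℚ)).IsElliptic]
    {M : ℕ} (hM : 1 ≤ M) {q : ℕ} (hq : q = 2 ^ M) [NeZero q]
    {ℓ : ℕ} [Fact ℓ.Prime] (hℓ2 : ℓ ≠ 2) (hℓd : ¬ ((ℓ : ℤ) ∣ NumberField.discr K))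
    (hgoodℓ : W.HasGoodReductionAtPrime ℓ) (hℓK : FrobEqFrobInfty W K 2 ℓ)
    {v : HeightOneSpectrum (𝓞 ℚ)} (hℓv : (ℓ : 𝓞 ℚ) ∈ v.asIdeal) (hMℓ : M ≤ Zhang2014.kolyvaginIndex W 2 ℓ)
    {s : galH1Torsion (W.quadraticTwist ((NumberField.discr K : ℤ) : ℚ)) (q : ℤ)}
    (hs : s ∈ selmerGroup (W.quadraticTwist ((NumberField.discr K : ℤ) : ℚ)) (q : ℤ))
    {d : galH1Torsion (W.quadraticTwist ((NumberField.discr K : ℤ) : ℚ)) (q : ℤ)}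
    (hdfin : ∀ w : HeightOneSpectrum (𝓞 ℚ), w ≠ v →
      d ∈ selmerLocalKer (W.quadraticTwist ((NumberField.discr K : ℤ) : ℚ)) (w.adicCompletion ℚ) (q : ℤ))
    (hdinf : ∀ w : InfinitePlace ℚ,
      d ∈ selmerLocalKer (W.quadraticTwist ((NumberField.discr K : ℤ) : ℚ)) w.Completion (q : ℤ))
    {a : ℕ} (hdv : ((2 : ℤ) ^ a) • d ∉
      selmerLocalKer (W.quadraticTwist ((NumberField.discr K : ℤ) : ℚ)) (v.adicCompletion ℚ) (q : ℤ)) :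
    ((2 : ℤ) ^ (M - 1 - a)) • s ∈
      (W.quadraticTwist ((NumberField.discr K : ℤ) : ℚ)).torsionLocalKer (v.adicCompletion ℚ) (q : ℤ) :=
  lemma_5_3_rat_two_of_card (W.quadraticTwist ((NumberField.discr K : ℤ) : ℚ)) hM hq hℓ2 hℓv
    (natCard_ker_nsmul_quadraticTwist_adicCompletion_two_pow_eq W hK hodd hΔ hℓ2 hℓd hgoodℓ hℓK hℓv hMℓ hq)
    hs hdfin hdinf hdv

end Summit.BirchSwinnertonDyer.BirchSwinnertonDyer.Theorems.GenusExact.FrobeniusCriterion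

end
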